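import Mathlib
import Literature.RepresentationTheory.FiniteGroups.BrauerInduction
import HarnessLib

/-!
# Stub `stub_a5PermCharRelation` — crux `QuinticDedekindPole` (stmt-Langlands-17270), line `Sketch`

A finite check on the `60` elements of `A₅ = alternatingGroup (Fin 5)`.  With the five-cycle
`c₅ = finRotate 5`, the three-cycle `c₃ = Fin.cycleRange 2`, `C₅ = C_{A₅}(c₅)`,
`D₅ = N_{A₅}({c₅, c₅⁻¹})`, `C₃ = C_{A₅}(c₃)`, `S₃ = N_{A₅}({c₃, c₃⁻¹})`, `A₄ = Stab_{A₅}(i)`: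

* `C₅ ≤ D₅` and `C₃ ≤ S₃`, both of relative index `2`;
* the permutation-character (Brauer–Kuroda) relation
  `Ind_⊤ 1 + Ind_{C₃} 1 + Ind_{D₅} 1 = Ind_{A₄} 1 + Ind_{S₃} 1 + Ind_{C₅} 1`
  (both sides are `3 + ρ₃ + ρ₃' + 2ρ₄ + 2ρ₅`), for every point stabiliser `A₄ = Stab(i)`.

Method.  `Ind_H^G 1 (s) = |H|⁻¹ · #{t | t⁻¹ s t ∈ H}` (`indClassFun_const_one_eq`); membership in
the six subgroups is replaced by cheap decidable tests (`u c = c u`, `u c u⁻¹ ∈ {c, c⁻¹}`,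
`u • i = i`); both sides are class functions (`indClassFun_conj`), every `s ∈ A₅` is conjugate to
one of `1, (01)(23), c₃, c₅, c₅²` (`decide`), and at these five representatives the counts are
evaluated by `decide` (kernel only, no `native_decide`; about 40 s of kernel time in total).
-/

set_option linter.dupNamespace false

noncomputable section

namespace Summit.Langlands.Langlands.Theorems.DedekindQuotient1951

open Literature.RepresentationTheory.FiniteGroups

/-! ### General lemmas (any finite group) -/

/-- `|H| = #{u | p u}` whenever `p` decides membership in `H`. [folklore] -/
private theorem natCard_eq_of_filter {G : Type} [Group G] [Fintype G] (H : Subgroup G)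
    (p : G → Prop) [DecidablePred p] (hp : ∀ u, p u ↔ u ∈ H) {n : ℕ}
    (hn : (Finset.univ.filter p).card = n) : Nat.card H = n := by
  rw [← hn]
  exact Nat.subtype_card _ fun x => by
    simp only [Finset.mem_filter, Finset.mem_univ, true_and, hp]

/-- `Ind_H^G 1 (s) = n⁻¹ · #{t ∈ G | p (t⁻¹ s t)}` whenever `p` decides membership in `H` and
`#{u | p u} = n` (Serre, *Linear Representations*, §7.2: the Frobenius formula for the
permutation character). [folklore] -/
private theorem indClassFun_const_one_eq {G : Type} [Group G] [Fintype G] (H : Subgroup G)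
    (p : G → Prop) [DecidablePred p] (hp : ∀ u, p u ↔ u ∈ H) {n : ℕ}
    (hn : (Finset.univ.filter p).card = n) (s : G) :
    indClassFun H (fun _ => (1 : ℂ)) s =
      (n : ℂ)⁻¹ * ((Finset.univ.filter fun t : G => p (t⁻¹ * s * t)).card : ℂ) := by
  rw [indClassFun_apply, natCard_eq_of_filter H p hp hn, Finset.natCast_card_filter]
  congr 1
  refine Finset.sum_congr rfl fun t _ => ?_
  split_ifs with h
  · exact extend_subtypeVal_apply H _ ⟨_, (hp _).1 h⟩
  · exact extend_subtypeVal_of_not_mem H _ fun h' => h ((hp _).2 h')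

/-- `Ind_G^G 1 = 1`. [folklore] -/
private theorem indClassFun_top_const_one {G : Type} [Group G] [Fintype G] (s : G) :
    indClassFun (⊤ : Subgroup G) (fun _ => (1 : ℂ)) s = 1 := by
  rw [indClassFun_apply]
  have h : ∀ t : G, Function.extend (Subtype.val : (⊤ : Subgroup G) → G) (fun _ => (1 : ℂ)) 0
      (t⁻¹ * s * t) = 1 := fun t =>
    extend_subtypeVal_apply (⊤ : Subgroup G) (fun _ => (1 : ℂ)) ⟨t⁻¹ * s * t, Subgroup.mem_top _⟩
  simp only [h, Finset.sum_const, Finset.card_univ, nsmul_eq_mul, mul_one, Subgroup.card_top,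
    Nat.card_eq_fintype_card]
  exact inv_mul_cancel₀ (Nat.cast_ne_zero.mpr Fintype.card_ne_zero)

/-- `g` normalises the pair `{c, c⁻¹}` iff `g c g⁻¹ ∈ {c, c⁻¹}`. [folklore] -/
private theorem mem_normalizer_pair_iff {G : Type*} [Group G] (c g : G) :
    g ∈ Subgroup.normalizer ({c, c⁻¹} : Set G) ↔ g * c * g⁻¹ = c ∨ g * c * g⁻¹ = c⁻¹ := by
  simp only [Subgroup.mem_set_normalizer_iff, Set.mem_insert_iff, Set.mem_singleton_iff]
  refine ⟨fun h => (h c).1 (Or.inl rfl), fun h n => ?_⟩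
  have key : ∀ m d : G, g * m * g⁻¹ = d ↔ m = g⁻¹ * d * g := fun m d => by
    constructor
    · rintro rfl; group
    · rintro rfl; group
  rw [key n c, key n c⁻¹]
  rcases h with h | h
  · have h1 : g⁻¹ * c * g = c := ((key c c).1 h).symm
    have h2 : g⁻¹ * c⁻¹ * g = c⁻¹ :=
      calc g⁻¹ * c⁻¹ * g = (g⁻¹ * c * g)⁻¹ := by group
        _ = c⁻¹ := by rw [h1]
    rw [h1, h2]
  · have h1 : g⁻¹ * c⁻¹ * g = c := ((key c c⁻¹).1 h).symm
    have h2 : g⁻¹ * c * g = c⁻¹ :=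
      calc g⁻¹ * c * g = (g⁻¹ * c⁻¹ * g)⁻¹ := by group
        _ = c⁻¹ := by rw [h1]
    rw [h1, h2]
    exact Or.comm

/-- The centraliser of `c` normalises `{c, c⁻¹}`. [folklore] -/
private theorem centralizer_le_normalizer_pair {G : Type*} [Group G] (c : G) :
    Subgroup.centralizer {c} ≤ Subgroup.normalizer ({c, c⁻¹} : Set G) := fun g hg => by
  rw [mem_normalizer_pair_iff]
  rw [Subgroup.mem_centralizer_singleton_iff] at hg
  exact Or.inl (by rw [hg, mul_inv_cancel_right])

/-- `|H| = m ≠ 0`, `|K| = 2m`, `H ≤ K` give `[K : H] = 2`. [folklore] -/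
private theorem relIndex_eq_two {G : Type*} [Group G] {H K : Subgroup G} (hle : H ≤ K) {m : ℕ}
    (hm : m ≠ 0) (hH : Nat.card H = m) (hK : Nat.card K = 2 * m) : H.relIndex K = 2 := by
  have h := Subgroup.relIndex_mul_relIndex ⊥ H K bot_le hle
  rw [Subgroup.relIndex_bot_left, Subgroup.relIndex_bot_left, hH, hK, mul_comm 2 m] at h
  exact Nat.eq_of_mul_eq_mul_left (Nat.pos_of_ne_zero hm) h

/-- `Ind_{C(c)} 1 (s) = n⁻¹ · #{t | t⁻¹ s t commutes with c}`, `n = |C(c)|`. [folklore] -/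
private theorem eval_centralizer {G : Type} [Group G] [Fintype G] [DecidableEq G] (c : G) {n : ℕ}
    (hn : (Finset.univ.filter fun u : G => u * c = c * u).card = n) (s : G) :
    indClassFun (Subgroup.centralizer {c}) (fun _ => (1 : ℂ)) s =
      (n : ℂ)⁻¹ *
        ((Finset.univ.filter fun t : G => t⁻¹ * s * t * c = c * (t⁻¹ * s * t)).card : ℂ) :=
  indClassFun_const_one_eq _ (fun u => u * c = c * u)
    (fun _ => Subgroup.mem_centralizer_singleton_iff.symm) hn s

/-- `Ind_{N({c, c⁻¹})} 1 (s) = n⁻¹ · #{t | t⁻¹ s t normalises {c, c⁻¹}}`, `n = |N({c, c⁻¹})|`.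
[folklore] -/
private theorem eval_normalizer {G : Type} [Group G] [Fintype G] [DecidableEq G] (c : G) {n : ℕ}
    (hn : (Finset.univ.filter fun u : G => u * c * u⁻¹ = c ∨ u * c * u⁻¹ = c⁻¹).card = n) (s : G) :
    indClassFun (Subgroup.normalizer ({c, c⁻¹} : Set G)) (fun _ => (1 : ℂ)) s =
      (n : ℂ)⁻¹ * ((Finset.univ.filter fun t : G =>
        t⁻¹ * s * t * c * (t⁻¹ * s * t)⁻¹ = c ∨
          t⁻¹ * s * t * c * (t⁻¹ * s * t)⁻¹ = c⁻¹).card : ℂ) :=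
  indClassFun_const_one_eq _ (fun u => u * c * u⁻¹ = c ∨ u * c * u⁻¹ = c⁻¹)
    (fun u => (mem_normalizer_pair_iff c u).symm) hn s

/-- `Ind_{Stab(i)} 1 (s) = n⁻¹ · #{t | t⁻¹ s t fixes i}`, `n = |Stab(i)|`. [folklore] -/
private theorem eval_stabilizer {G : Type} [Group G] [Fintype G] {α : Type*} [MulAction G α]
    [DecidableEq α] (i : α) {n : ℕ} (hn : (Finset.univ.filter fun u : G => u • i = i).card = n)
    (s : G) :
    indClassFun (MulAction.stabilizer G i) (fun _ => (1 : ℂ)) s =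
      (n : ℂ)⁻¹ * ((Finset.univ.filter fun t : G => (t⁻¹ * s * t) • i = i).card : ℂ) :=
  indClassFun_const_one_eq _ (fun u => u • i = i) (fun _ => MulAction.mem_stabilizer_iff.symm) hn s

/-- Clearing denominators: the counting identity in `ℕ` gives the character identity in `ℂ`.
[folklore] -/
private theorem complex_identity_of_counts (a b c d e : ℕ)
    (h : 60 + 20 * a + 6 * b = 5 * c + 10 * d + 12 * e) :
    (1 : ℂ) + ((3 : ℕ) : ℂ)⁻¹ * (a : ℂ) + ((10 : ℕ) : ℂ)⁻¹ * (b : ℂ) =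
      ((12 : ℕ) : ℂ)⁻¹ * (c : ℂ) + ((6 : ℕ) : ℂ)⁻¹ * (d : ℂ) + ((5 : ℕ) : ℂ)⁻¹ * (e : ℂ) := by
  have h' : ((60 + 20 * a + 6 * b : ℕ) : ℂ) = ((5 * c + 10 * d + 12 * e : ℕ) : ℂ) :=
    congrArg Nat.cast h
  push_cast at h' ⊢
  linear_combination (1 / 60 : ℂ) * h'

/-! ### The finite computations in `A₅` (kernel `decide`)

`c₅ = finRotate 5 = (0 1 2 3 4)`, `c₃ = Fin.cycleRange 2 = (0 1 2)`, `d₂₂ = (0 1)(2 3)`. -/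

/-- The double transposition `(0 1)(2 3)` is even. [folklore] -/
private theorem swap_mul_swap_mem :
    Equiv.swap (0 : Fin 5) 1 * Equiv.swap 2 3 ∈ alternatingGroup (Fin 5) :=
  Equiv.Perm.mem_alternatingGroup.2 (by decide)

/-- Every element of `A₅` is `A₅`-conjugate to one of `1, (01)(23), c₃, c₅, c₅²`
(representatives of the five conjugacy classes of `A₅`). [folklore] -/
private theorem exists_conj_rep : ∀ s : alternatingGroup (Fin 5), ∃ g : alternatingGroup (Fin 5),
    g * s * g⁻¹ = 1 ∨
    g * s * g⁻¹ = (⟨Equiv.swap (0 : Fin 5) 1 * Equiv.swap 2 3,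
      swap_mul_swap_mem⟩ : alternatingGroup (Fin 5)) ∨
    g * s * g⁻¹ = (⟨Fin.cycleRange 2,
      (@Fin.isThreeCycle_cycleRange_two 2).mem_alternatingGroup⟩ : alternatingGroup (Fin 5)) ∨
    g * s * g⁻¹ = (⟨finRotate 5,
      @Equiv.Perm.finRotate_bit1_mem_alternatingGroup 2⟩ : alternatingGroup (Fin 5)) ∨
    g * s * g⁻¹ = (⟨finRotate 5,
      @Equiv.Perm.finRotate_bit1_mem_alternatingGroup 2⟩ : alternatingGroup (Fin 5)) *
      (⟨finRotate 5,
        @Equiv.Perm.finRotate_bit1_mem_alternatingGroup 2⟩ : alternatingGroup (Fin 5)) := by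
  decide +kernel

/-- `|C_{A₅}(c₅)| = 5`. [folklore] -/
private theorem card_C5 : ∀ c : alternatingGroup (Fin 5),
    c = (⟨finRotate 5,
      @Equiv.Perm.finRotate_bit1_mem_alternatingGroup 2⟩ : alternatingGroup (Fin 5)) →
    (Finset.univ.filter fun u : alternatingGroup (Fin 5) => u * c = c * u).card = 5 := by
  rintro c rfl
  decide +kernel

/-- `|N_{A₅}({c₅, c₅⁻¹})| = 10`. [folklore] -/
private theorem card_D5 : ∀ c : alternatingGroup (Fin 5),
    c = (⟨finRotate 5,
      @Equiv.Perm.finRotate_bit1_mem_alternatingGroup 2⟩ : alternatingGroup (Fin 5)) →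
    (Finset.univ.filter fun u : alternatingGroup (Fin 5) =>
      u * c * u⁻¹ = c ∨ u * c * u⁻¹ = c⁻¹).card = 10 := by
  rintro c rfl
  decide +kernel

/-- `|C_{A₅}(c₃)| = 3`. [folklore] -/
private theorem card_C3 : ∀ c : alternatingGroup (Fin 5),
    c = (⟨Fin.cycleRange 2,
      (@Fin.isThreeCycle_cycleRange_two 2).mem_alternatingGroup⟩ : alternatingGroup (Fin 5)) →
    (Finset.univ.filter fun u : alternatingGroup (Fin 5) => u * c = c * u).card = 3 := by
  rintro c rfl
  decide +kernel

/-- `|N_{A₅}({c₃, c₃⁻¹})| = 6`. [folklore] -/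
private theorem card_S3 : ∀ c : alternatingGroup (Fin 5),
    c = (⟨Fin.cycleRange 2,
      (@Fin.isThreeCycle_cycleRange_two 2).mem_alternatingGroup⟩ : alternatingGroup (Fin 5)) →
    (Finset.univ.filter fun u : alternatingGroup (Fin 5) =>
      u * c * u⁻¹ = c ∨ u * c * u⁻¹ = c⁻¹).card = 6 := by
  rintro c rfl
  decide +kernel

/-- `|Stab_{A₅}(i)| = 12`. [folklore] -/
private theorem card_stab : ∀ i : Fin 5,
    (Finset.univ.filter fun u : alternatingGroup (Fin 5) => u • i = i).card = 12 := by
  decide +kernel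

/-- The fixed-point counts `#{t | (t⁻¹ r t) • i = i}` at the five class representatives.
[folklore] -/
private theorem stab_counts : ∀ i : Fin 5,
    (Finset.univ.filter fun t : alternatingGroup (Fin 5) => (t⁻¹ * 1 * t) • i = i).card = 60 ∧
    (Finset.univ.filter fun t : alternatingGroup (Fin 5) =>
      (t⁻¹ * (⟨Equiv.swap (0 : Fin 5) 1 * Equiv.swap 2 3,
        swap_mul_swap_mem⟩ : alternatingGroup (Fin 5)) * t) • i = i).card = 12 ∧
    (Finset.univ.filter fun t : alternatingGroup (Fin 5) =>
      (t⁻¹ * (⟨Fin.cycleRange 2,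
        (@Fin.isThreeCycle_cycleRange_two 2).mem_alternatingGroup⟩ : alternatingGroup (Fin 5)) *
        t) • i = i).card = 24 ∧
    (Finset.univ.filter fun t : alternatingGroup (Fin 5) =>
      (t⁻¹ * (⟨finRotate 5,
        @Equiv.Perm.finRotate_bit1_mem_alternatingGroup 2⟩ : alternatingGroup (Fin 5)) *
        t) • i = i).card = 0 ∧
    (Finset.univ.filter fun t : alternatingGroup (Fin 5) =>
      (t⁻¹ * ((⟨finRotate 5,
        @Equiv.Perm.finRotate_bit1_mem_alternatingGroup 2⟩ : alternatingGroup (Fin 5)) *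
        (⟨finRotate 5,
          @Equiv.Perm.finRotate_bit1_mem_alternatingGroup 2⟩ : alternatingGroup (Fin 5))) *
        t) • i = i).card = 0 := by
  decide +kernel

/-! ### The stub -/

/-- **stub_a5PermCharRelation** (finite check on the 60 elements of `A₅`): with the five-cycle
`c₅ = finRotate 5`, the three-cycle `c₃ = Fin.cycleRange 2`, `C₅ = C_{A₅}(c₅)`,
`D₅ = N_{A₅}({c₅, c₅⁻¹})`, `C₃ = C_{A₅}(c₃)`, `S₃ = N_{A₅}({c₃, c₃⁻¹})`, `A₄ = Stab_{A₅}(i)`: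
`C₅ ≤ D₅` and `C₃ ≤ S₃` with relative index `2`, and the permutation-character relation
`Ind_⊤ 1 + Ind_{C₃} 1 + Ind_{D₅} 1 = Ind_{A₄} 1 + Ind_{S₃} 1 + Ind_{C₅} 1` (both sides
`3 + ρ₃ + ρ₃' + 2ρ₄ + 2ρ₅`) for every point stabiliser `A₄ = Stab(i)`; in Dedekind-zeta terms
`ζ · ζ_{K₂₀} · ζ_{K₆} = ζ_{K₅} · ζ_{K₁₀} · ζ_{K₁₂}`. [cite: Booker2006, §2 Prop. 3] -/
theorem stub_a5PermCharRelation :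
    Subgroup.centralizer {(⟨finRotate 5, @Equiv.Perm.finRotate_bit1_mem_alternatingGroup 2⟩ : alternatingGroup (Fin 5))}
        ≤ Subgroup.normalizer ({(⟨finRotate 5, @Equiv.Perm.finRotate_bit1_mem_alternatingGroup 2⟩ : alternatingGroup (Fin 5)), (⟨finRotate 5, @Equiv.Perm.finRotate_bit1_mem_alternatingGroup 2⟩ : alternatingGroup (Fin 5))⁻¹} : Set (alternatingGroup (Fin 5))) ∧
    (Subgroup.centralizer {(⟨finRotate 5, @Equiv.Perm.finRotate_bit1_mem_alternatingGroup 2⟩ : alternatingGroup (Fin 5))}).relIndex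
        (Subgroup.normalizer ({(⟨finRotate 5, @Equiv.Perm.finRotate_bit1_mem_alternatingGroup 2⟩ : alternatingGroup (Fin 5)), (⟨finRotate 5, @Equiv.Perm.finRotate_bit1_mem_alternatingGroup 2⟩ : alternatingGroup (Fin 5))⁻¹} : Set (alternatingGroup (Fin 5)))) = 2 ∧
    Subgroup.centralizer {(⟨Fin.cycleRange 2, (@Fin.isThreeCycle_cycleRange_two 2).mem_alternatingGroup⟩ : alternatingGroup (Fin 5))}
        ≤ Subgroup.normalizer ({(⟨Fin.cycleRange 2, (@Fin.isThreeCycle_cycleRange_two 2).mem_alternatingGroup⟩ : alternatingGroup (Fin 5)), (⟨Fin.cycleRange 2, (@Fin.isThreeCycle_cycleRange_two 2).mem_alternatingGroup⟩ : alternatingGroup (Fin 5))⁻¹} : Set (alternatingGroup (Fin 5))) ∧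
    (Subgroup.centralizer {(⟨Fin.cycleRange 2, (@Fin.isThreeCycle_cycleRange_two 2).mem_alternatingGroup⟩ : alternatingGroup (Fin 5))}).relIndex
        (Subgroup.normalizer ({(⟨Fin.cycleRange 2, (@Fin.isThreeCycle_cycleRange_two 2).mem_alternatingGroup⟩ : alternatingGroup (Fin 5)), (⟨Fin.cycleRange 2, (@Fin.isThreeCycle_cycleRange_two 2).mem_alternatingGroup⟩ : alternatingGroup (Fin 5))⁻¹} : Set (alternatingGroup (Fin 5)))) = 2 ∧
    ∀ i : Fin 5,
      indClassFun (⊤ : Subgroup (alternatingGroup (Fin 5))) (fun _ => (1 : ℂ))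
        + indClassFun (Subgroup.centralizer {(⟨Fin.cycleRange 2, (@Fin.isThreeCycle_cycleRange_two 2).mem_alternatingGroup⟩ : alternatingGroup (Fin 5))}) (fun _ => (1 : ℂ))
        + indClassFun (Subgroup.normalizer ({(⟨finRotate 5, @Equiv.Perm.finRotate_bit1_mem_alternatingGroup 2⟩ : alternatingGroup (Fin 5)), (⟨finRotate 5, @Equiv.Perm.finRotate_bit1_mem_alternatingGroup 2⟩ : alternatingGroup (Fin 5))⁻¹} : Set (alternatingGroup (Fin 5)))) (fun _ => (1 : ℂ))
      = indClassFun (MulAction.stabilizer (alternatingGroup (Fin 5)) i) (fun _ => (1 : ℂ))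
        + indClassFun (Subgroup.normalizer ({(⟨Fin.cycleRange 2, (@Fin.isThreeCycle_cycleRange_two 2).mem_alternatingGroup⟩ : alternatingGroup (Fin 5)), (⟨Fin.cycleRange 2, (@Fin.isThreeCycle_cycleRange_two 2).mem_alternatingGroup⟩ : alternatingGroup (Fin 5))⁻¹} : Set (alternatingGroup (Fin 5)))) (fun _ => (1 : ℂ))
        + indClassFun (Subgroup.centralizer {(⟨finRotate 5, @Equiv.Perm.finRotate_bit1_mem_alternatingGroup 2⟩ : alternatingGroup (Fin 5))}) (fun _ => (1 : ℂ)) := by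
  refine ⟨centralizer_le_normalizer_pair _, ?_, centralizer_le_normalizer_pair _, ?_, fun i => ?_⟩
  · exact relIndex_eq_two (centralizer_le_normalizer_pair _) (by norm_num)
      (natCard_eq_of_filter _ _ (fun _ => Subgroup.mem_centralizer_singleton_iff.symm)
        (card_C5 _ rfl))
      (natCard_eq_of_filter _ _ (fun u => (mem_normalizer_pair_iff _ u).symm) (card_D5 _ rfl))
  · exact relIndex_eq_two (centralizer_le_normalizer_pair _) (by norm_num)
      (natCard_eq_of_filter _ _ (fun _ => Subgroup.mem_centralizer_singleton_iff.symm)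
        (card_C3 _ rfl))
      (natCard_eq_of_filter _ _ (fun u => (mem_normalizer_pair_iff _ u).symm) (card_S3 _ rfl))
  · funext s
    obtain ⟨g, hg⟩ := exists_conj_rep s
    have hs : s = g⁻¹ * (g * s * g⁻¹) * g⁻¹⁻¹ := by group
    rw [hs]
    generalize g * s * g⁻¹ = u at hg ⊢
    simp only [Pi.add_apply, indClassFun_conj]
    obtain ⟨h1, h2, h3, h4, h5⟩ := stab_counts i
    rcases hg with rfl | rfl | rfl | rfl | rfl <;>
      rw [indClassFun_top_const_one, eval_centralizer _ (card_C3 _ rfl),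
        eval_normalizer _ (card_D5 _ rfl), eval_stabilizer i (card_stab i),
        eval_normalizer _ (card_S3 _ rfl), eval_centralizer _ (card_C5 _ rfl)] <;>
      [rw [h1]; rw [h2]; rw [h3]; rw [h4]; rw [h5]] <;>
      refine complex_identity_of_counts _ _ _ _ _ ?_ <;>
      decide +kernel

end Summit.Langlands.Langlands.Theorems.DedekindQuotient1951

end
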